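import Summits.Parity.GeneralizedHardyLittlewood.Theorems.LZZCertificateReplayUnconditionalLeaf
import Summits.QuantumAdvantage.QuantumAdvantage.Theorems.LinnikCubicClassGroupsDegreeOnePrimesEscapeClassPNTSiegel
import Literature.NumberTheory.LFunctions.ClassGroupLFunctionNoExceptionalZeroUpTo

/-!
# Route `LZZCertificateReplay` — consumer C4″: the class prime number theorem with NO exceptional
# term in the Linnik range, for every number field whose discriminant lies in a certified table

Cell `parity-realchar` (summit Parity, column REALCHAR), kernel side; consumer C4 of
`CONSUMERS.md`/`TARGET.md §5` ("the input the Linnik-range class-PNT theorems of the tree take in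
the no-Siegel-zero case, for fields WITH a small quadratic subfield"). LABEL: instrument / kernel
consumer; no Parity credit (cell rule H5).

The tree's engine `classPNT_eps_of_zeroRepulsion` (cell linnik-cubic, file
`…DegreeOnePrimesEscapeClassPNTSiegel.lean`) turns a repulsion bound `β ≤ 1 − 1/log R` for the
possible real zero `β` of the real class group characters of `K` into
`|π_C(x) − Li(x)/h_K| ≤ ε·Li(x)/h_K` for `x ≥ Q_K^{c₁}`, `x ≥ R^{c₀}` (`Q_K = |d_K|·nⁿ`). There it is fed
(i) by Siegel's theorem (ineffective, range `exp(c|d_K|^δ)`), (ii) by the conjecture `NoSiegelZeros`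
(Linnik range `Q_K^{c₁}`, every field, CONDITIONAL), (iii) in odd degree by Stark. Here it is fed by a
certified TABLE: under `NoExceptionalZeroUpTo Q c₀` the landed consumer
`classGroupLFunction_ne_zero_of_noExceptionalZeroUpTo` (Stark descent, `ClassGroupLFunctionNoExceptionalZeroUpTo.lean`)
repels every such `β` to `β < 1 − min(c₀,1)/(8·(2n)!·log|d_K|)` whenever `|d_K| ≤ Q`, i.e.
`R = Q_K^{8·(2n)!/min(c₀,1)}` — so the Linnik range `x ≥ Q_K^{c₁}` holds with NO exceptional term for
every field in the table's range, with `c₁ = c₁(n, ε, c₀)` chosen BEFORE `Q` (uniform in the table):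

* `classPNT_eps_of_noExceptionalZeroUpTo` — for `n > 1`, `ε > 0`, `c₀ > 0` there is `c₁ > 0` such that
  for EVERY `Q` with `NoExceptionalZeroUpTo Q c₀`, every number field `K` of degree `n` with `|d_K| ≤ Q`,
  every ideal class `C` and every `x ≥ Q_K^{c₁}`: `|π_C(x) − Li(x)/h_K| ≤ ε·Li(x)/h_K`;
* `classPNT_eps_of_noRealZeroUpTo` — the same under a wide table `NoRealZeroUpTo Q` (`c₀ = 1`);
* `kernel_classPNT_eps` — **UNCONDITIONAL instance at `Q = 4·10⁵`** from the kernel leaf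
  `noExceptionalZeroUpTo_4e5_fifth` (`c₀ = 1/5`): class PNT with no exceptional term in the Linnik range
  for every number field of degree `n` with `|d_K| ≤ 4·10⁵`, constants depending on `(n, ε)` only.

WHAT THIS IS NOT: nothing for `|d_K| > Q`; the constants `c₁` are not made explicit (they are the
engine's); the least-prime-ideal corollary is NOT drawn here because the tree already has it
UNCONDITIONALLY in every degree (`exists_prime_mem_class_absNorm_le`, Deuring–Heilbronn) — a table adds
nothing to it. No claim about complex zeros or about `x < Q_K^{c₁}`.

References: [cite: ThornerZaman2019, Thm. 1.4] (the dichotomy with `β₁`); [cite: Stark1974, Thm. 3];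
[cite: LuZamanZhao2026, Theorem 1.1] (the printed table to `10¹⁰`; here the kernel leaf to `4·10⁵`).
-/

noncomputable section

open Complex Real MeasureTheory Set Filter Topology
open scoped NumberField nonZeroDivisors

namespace Summit.Parity.GeneralizedHardyLittlewood.Theorems

open Literature.NumberTheory.LFunctions Literature.NumberTheory.LFunctions.NumberField
  Summit.QuantumAdvantage.QuantumAdvantage.Theorems.DegreeOnePrimesEscape

/-- **Class PNT with NO exceptional term in the Linnik range, uniformly over a narrow table
(consumer C4″).** For `n > 1`, `ε > 0`, `c₀ > 0` there is `c₁ > 0` (depending on `n, ε, c₀` only) such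
that for every `Q` with `NoExceptionalZeroUpTo Q c₀`, every number field `K` of degree `n` with
`|d_K| ≤ Q`, every ideal class `C` of `K` and every `x ≥ Q_K^{c₁}` (`Q_K = |d_K|·nⁿ`):
`|π_C(x) − Li(x)/h_K| ≤ ε·Li(x)/h_K`. (Engine `classPNT_eps_of_zeroRepulsion` with
`R = Q_K^{max(8·(2n)!/min(c₀,1), 1)}`; repulsion by `classGroupLFunction_ne_zero_of_noExceptionalZeroUpTo`.)
[cite: ThornerZaman2019, Thm. 1.4] [cite: Stark1974, Thm. 3] -/
theorem classPNT_eps_of_noExceptionalZeroUpTo (n : ℕ) (hn : 1 < n) {ε c₀ : ℝ} (hε : 0 < ε)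
    (hc₀ : 0 < c₀) :
    ∃ c₁ : ℝ, 0 < c₁ ∧ ∀ (Q : ℕ), NoExceptionalZeroUpTo Q c₀ →
      ∀ (K : Type) [Field K] [NumberField K], Module.finrank ℚ K = n →
        (NumberField.discr K).natAbs ≤ Q →
        ∀ (C : ClassGroup (𝓞 K)) (x : ℝ), ThornerZaman.condQn K ^ c₁ ≤ x →
          |(primeIdealClassCount K C x : ℝ) - offsetLogIntegral x / NumberField.classNumber K| ≤
            ε * offsetLogIntegral x / NumberField.classNumber K := by
  classical
  obtain ⟨c₁, c', hc₁, hc', h⟩ := classPNT_eps_of_zeroRepulsion n hn hε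
  set m : ℝ := min c₀ 1 with hm
  have hm0 : 0 < m := lt_min hc₀ one_pos
  set e : ℝ := max (8 * ((2 * n).factorial : ℝ) / m) 1 with he
  have he1 : 1 ≤ e := le_max_right _ _
  have he0 : 0 < e := by linarith
  refine ⟨max c₁ (c' * e), lt_max_of_lt_left hc₁, fun Q hN K _ _ hKn hdQ Cl x hx => ?_⟩
  have hK : 1 < Module.finrank ℚ K := by rw [hKn]; exact hn
  set QK : ℝ := ThornerZaman.condQn K with hQK
  have hQ12 : (12 : ℝ) ≤ QK := ThornerZaman.twelve_le_condQn (K := K) hK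
  have hQ1 : (1 : ℝ) < QK := by linarith
  have hlogQ : 2 ≤ Real.log QK := two_lt_log_twelve.le.trans (Real.log_le_log (by norm_num) hQ12)
  have hfac0 : (0 : ℝ) < ((2 * n).factorial : ℝ) := by exact_mod_cast Nat.factorial_pos _
  -- `|d_K| ≥ 3`, `0 < log|d_K| ≤ log Q_K`
  have hd3 : (3 : ℝ) ≤ ((NumberField.discr K).natAbs : ℝ) := by
    have h2 := NumberField.abs_discr_gt_two hK
    rw [Nat.cast_natAbs]
    exact_mod_cast (show (3 : ℤ) ≤ |NumberField.discr K| by omega)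
  have hlogd : 0 < Real.log ((NumberField.discr K).natAbs : ℝ) := Real.log_pos (by linarith)
  have hdQK : Real.log ((NumberField.discr K).natAbs : ℝ) ≤ Real.log QK := by
    refine Real.log_le_log (by linarith) ?_
    rw [Nat.cast_natAbs, Int.cast_abs]
    exact ThornerZaman.abs_discr_le_condQn K
  -- the repulsion parameter `R = Q_K^e ≥ Q_K ≥ 12`, `log R = e log Q_K ≥ (8(2n)!/m) log Q_K`
  set R : ℝ := QK ^ e with hR
  have hR12 : (12 : ℝ) ≤ R := by
    have := Real.rpow_le_rpow_of_exponent_le hQ1.le he1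
    rw [Real.rpow_one] at this
    exact hQ12.trans this
  have hlogR : Real.log R = e * Real.log QK := by rw [hR, Real.log_rpow (by linarith)]
  have hrep : ∀ χ : ClassGroup (𝓞 K) →* ℂˣ, χ * χ = 1 → ∀ β : ℝ,
      1 - 1 / (8 * Real.log (ThornerZaman.condQn K)) < β → β < 1 →
        classGroupLFunction K χ β = 0 → β ≤ 1 - 1 / Real.log R := by
    intro χ hχ β _ hβ1 hz
    by_contra hlt
    push Not at hlt
    -- `1 − m/(8(2n)! log d) ≤ 1 − 1/log R < β`
    have h1 : 1 / Real.log R ≤ m / (8 * ((2 * Module.finrank ℚ K).factorial : ℝ) *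
        Real.log ((NumberField.discr K).natAbs : ℝ)) := by
      rw [hKn, hlogR, div_le_div_iff₀ (by positivity) (by positivity), one_mul]
      have h2 : 8 * ((2 * n).factorial : ℝ) ≤ e * m := by
        have := le_max_left (8 * ((2 * n).factorial : ℝ) / m) 1
        rw [← he] at this
        have := mul_le_mul_of_nonneg_right this hm0.le
        rwa [div_mul_cancel₀ _ hm0.ne'] at this
      calc 8 * ((2 * n).factorial : ℝ) * Real.log ((NumberField.discr K).natAbs : ℝ)
          ≤ (e * m) * Real.log QK := mul_le_mul h2 hdQK hlogd.le (by positivity)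
        _ = m * (e * Real.log QK) := by ring
    have hσ : 1 - min c₀ 1 / (8 * ((2 * Module.finrank ℚ K).factorial : ℝ) *
        Real.log ((NumberField.discr K).natAbs : ℝ)) ≤ β := by rw [← hm]; linarith
    exact classGroupLFunction_ne_zero_of_noExceptionalZeroUpTo hN hc₀ K hK hdQ χ hχ hσ hβ1 hz
  refine h K hKn R hR12 hrep Cl x ?_ ?_
  · exact (Real.rpow_le_rpow_of_exponent_le hQ1.le (le_max_left _ _)).trans hx
  · -- `R^{c'} = Q_K^{e c'} ≤ Q_K^{max c₁ (c' e)} ≤ x`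
    rw [hR, ← Real.rpow_mul (by linarith)]
    have : e * c' = c' * e := mul_comm _ _
    rw [this]
    exact (Real.rpow_le_rpow_of_exponent_le hQ1.le (le_max_right _ _)).trans hx

/-- **The same under a wide table** `NoRealZeroUpTo Q` (a narrow table of width `c₀ = 1`,
`NoRealZeroUpTo.noExceptionalZeroUpTo`): for `n > 1`, `ε > 0` there is `c₁ > 0` such that for every `Q`
with `NoRealZeroUpTo Q`, every number field `K` of degree `n` with `|d_K| ≤ Q`, every class `C` and
every `x ≥ Q_K^{c₁}`: `|π_C(x) − Li(x)/h_K| ≤ ε·Li(x)/h_K`. [cite: ThornerZaman2019, Thm. 1.4] -/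
theorem classPNT_eps_of_noRealZeroUpTo (n : ℕ) (hn : 1 < n) {ε : ℝ} (hε : 0 < ε) :
    ∃ c₁ : ℝ, 0 < c₁ ∧ ∀ (Q : ℕ), NoRealZeroUpTo Q →
      ∀ (K : Type) [Field K] [NumberField K], Module.finrank ℚ K = n →
        (NumberField.discr K).natAbs ≤ Q →
        ∀ (C : ClassGroup (𝓞 K)) (x : ℝ), ThornerZaman.condQn K ^ c₁ ≤ x →
          |(primeIdealClassCount K C x : ℝ) - offsetLogIntegral x / NumberField.classNumber K| ≤
            ε * offsetLogIntegral x / NumberField.classNumber K := by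
  obtain ⟨c₁, hc₁, h⟩ := classPNT_eps_of_noExceptionalZeroUpTo n hn hε one_pos
  exact ⟨c₁, hc₁, fun Q hW K _ _ hKn hdQ C x hx => h Q (hW.noExceptionalZeroUpTo 1) K hKn hdQ C x hx⟩

/-- **Class PNT with NO exceptional term in the Linnik range for every number field with
`|d_K| ≤ 4·10⁵`, UNCONDITIONAL (kernel instance of consumer C4″).** For `n > 1` and `ε > 0` there is
`c₁ > 0` (depending on `n, ε` only — it is the constant of `classPNT_eps_of_noExceptionalZeroUpTo` at
`c₀ = 1/5`, fixed before any range) such that for every number field `K` of degree `n` with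
`|d_K| ≤ 4·10⁵`, every ideal class `C` and every `x ≥ Q_K^{c₁}` (`Q_K = |d_K|·nⁿ`):
`|π_C(x) − Li(x)/h_K| ≤ ε·Li(x)/h_K`. Trust base: the Lean kernel (leaf `noExceptionalZeroUpTo_4e5_fifth`),
no Platt, no Theorem 2.1, no `NoSiegelZeros`. -/
theorem kernel_classPNT_eps (n : ℕ) (hn : 1 < n) {ε : ℝ} (hε : 0 < ε) :
    ∃ c₁ : ℝ, 0 < c₁ ∧ ∀ (K : Type) [Field K] [NumberField K], Module.finrank ℚ K = n →
      (NumberField.discr K).natAbs ≤ 400000 →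
        ∀ (C : ClassGroup (𝓞 K)) (x : ℝ), ThornerZaman.condQn K ^ c₁ ≤ x →
          |(primeIdealClassCount K C x : ℝ) - offsetLogIntegral x / NumberField.classNumber K| ≤
            ε * offsetLogIntegral x / NumberField.classNumber K := by
  obtain ⟨c₁, hc₁, h⟩ :=
    classPNT_eps_of_noExceptionalZeroUpTo n hn hε (by norm_num : (0 : ℝ) < 1 / 5)
  exact ⟨c₁, hc₁, fun K _ _ hKn hdQ C x hx => h 400000 noExceptionalZeroUpTo_4e5_fifth K hKn hdQ C x hx⟩

end Summit.Parity.GeneralizedHardyLittlewood.Theorems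

end
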